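import Summits.AtomisticToContinuum.Crystallization.Theses.IsometryAtoms
import Summits.AtomisticToContinuum.Crystallization.Theses.PalmUnimodularRigidity
import Summits.AtomisticToContinuum.Crystallization.Theorems.PalmUnimodularRigidityCruxesToPalmRigidity
import Summits.AtomisticToContinuum.Crystallization.Theorems.PalmUnimodularRigidityShellsToBarlowChart
import Summits.AtomisticToContinuum.Crystallization.Theorems.PalmUnimodularRigidityLayeredLawsSelectHcpUniqueMinimiser
import Summits.AtomisticToContinuum.Crystallization.Theorems.ExcessDecayLiouvilleCoarseGrainsHcpEnergySeries
import Summits.AtomisticToContinuum.Crystallization.Theorems.PalmUnimodularRigidityCrysPeriodicBddBelow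

/-!
# Line `hcp-transfer` — crux `IsometryAtoms.MinimisingLawsHaveAtoms` (PURITY, stmt-AtomisticToContinuum-15776)
# from the two shared open Palm cruxes of route `PalmUnimodularRigidity`

Strategist line (planner `cstrat-stmt-AtomisticToContinuum-15776-b1`, 2026-08-17; lens TRANSFER at crux
level: the sibling route `PalmUnimodularRigidity` attacks "classify the minimising point-stationary hard-core
laws" head-on, and its target `PalmRigidity` (stmt-9224: a.s. a rotated relaxed hcp crystal with optimal
parameters) sits strictly above PURITY). Registered next to the birth line `Lines/birth.lean` (structure-free
Cantor–Bendixson cut); the two lines share no stub.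

THE CRUX (verbatim the route decl): every probability law `P` on rooted configurations of `ℝ³` that is a.s.
`IsRootedHardCore δ`, `IsPointStationaryLaw` and minimising (`E_P[rootEnergy V_LJ] ≤ e* = ⨅_Q e(Q)`) charges
the exact rooted isometry class of ONE set `Y ⊂ ℝ³`.

THE LINE. Two registered stubs, both BY CONSTRUCTION the open crux items of the sibling route (verbatim
signatures, so that they de-duplicate onto stmt-9225 / stmt-9226 and are staffed ONCE), and a sorry-free
composition through three landed theorems:

* `stub_minimiserShells` = `PalmUnimodularRigidity.MinimiserShells` (stmt-AtomisticToContinuum-9225, open,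
  rank 2 there; the LJ local close-packing statement in law: a.s. the root of a minimising point-stationary
  hard-core law has a (1/100)-close-packed twelve-shell — THE CONTENT, open-problem strength; declared
  mechanism there: an expectation inequality `E_P[h] ≥ e* + c·P(bad root shell)` with the Mecke identities of
  the typical Delaunay star as exact linear constraints).
* `stub_layeredLawsSelectHcp` = `PalmUnimodularRigidity.LayeredLawsSelectHcp` (stmt-AtomisticToContinuum-9226,
  open, XL; selection + rigidity in density form: an a.s. everywhere-close-packed, Barlow-charted minimising
  law is a.s. an EXACT rotated relaxed hcp with optimal parameters; Hägg domination is landed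
  (`stub_haggDominationAllRanges`, `stub_J2neg`), the elastic exactness in the 1 % tube is the live part).
* landed: `ShellsToBarlowChart_of` (stmt-9227, the robust layer theorem), `cruxesToPalmRigidity_proof`
  (stmt-9228: shells → chart → selection → `PalmRigidity`, incl. "root a.s. ⇒ every point a.s."), and
  `tube_hcpE_unique_minimiser` (the global minimiser of the hcp energy function `hcpE` is unique).

COMPOSITION (`MinimisingLawsHaveAtoms_of`, sorry-free, concludes the route decl BY NAME; hypotheses = the two
sibling items by name, registered obligations). `PalmRigidity` is NOT yet the crux: it yields a.s. SOME optimal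
`(a, h)` (sample-dependent) with `μ = count|A(hcpStacking a h)`; an atom needs ONE pair charged. Pinning is
free (`e(hcp a h) = e*` makes `(a, h)` a global minimiser of `hcpE`, `ciInf_le crysPeriodicBddBelow_proof` and
the landed series identity `hcpE = e(hcp · ·)`), and `tube_hcpE_unique_minimiser` makes the optimal pair
unique; so almost every sample is `count|A(Y − 0)` for the SAME `Y = hcpStacking a₀ h₀` (`0 ∈ Y`), whose rooted
class has outer measure `1 > 0`. This closes, inside the line, the "continuum of optimal parameters" gap that
separates a.s.-hcp from an exact atom (the birth line's `stub_minimisingCrystalsCountable`, here PROVED in the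
hcp family). The frame hypotheses of the two routes agree definitionally (`IsRootedHardCore`,
`IsPointStationaryLaw`, `rootEnergy` are the sibling's inlined forms).

WHY THIS TRANSFER HAS TEETH (and what it costs). PURITY quantified over ALL minimising laws forces, for an
ergodic law, a.s. exact crystallinity (the atom event is re-rooting invariant), so any proof must establish
a.s. structure at EVERY site; the structure-free formulation has no local-to-global engine, whereas naming hcp
buys LOCALISABILITY: shells are checkable site by site and the landed `ShellsToBarlowChart_of` globalises them.
Cost: the line bets on close packing (a Frank–Kasper-type optimal crystal would make stub 1 false and PURITY
still true) and on hcp among stackings (landed Hägg domination). Both stubs are staffed under the sibling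
route with registered skeleton lines of their own; a lead on THIS crux choosing this line should claim stubs
there, not re-derive them.

CALIBRATION. Neither stub gives the crux or the summit on its own (stub 1 has no global structure, stub 2 is
conditional on an a.s. Barlow chart); `PalmRigidity → crux` needed the uniqueness theorem (above), `crux →
stub i` fails (an atom says nothing about shells of the uncharged mass). Probes: strategist session files
`bc/hcp_transfer_*.lean` (exact? / simpa / aesop batteries against crux and `Crystallization`, all fail).

DISPROOF USED: none on file for this crux (no `Disproof.lean`, no `Negative/`); `ledger negatives` (21 entries,
2026-08-17) has no law-level statement; the stubs are live items, not instances of refuted statements.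
-/

noncomputable section

namespace Summit.AtomisticToContinuum.Crystallization.Cruxes.MinimisingLawsHaveAtoms.HcpTransfer

open MeasureTheory Set
open Literature.MathematicalPhysics.StatisticalMechanics Literature.Probability.Process
open Summit.AtomisticToContinuum.Crystallization.Theses.IsometryAtoms (MinimisingLawsHaveAtoms)
open Summit.AtomisticToContinuum.Crystallization.Theses.PalmUnimodularRigidity
  (MinimiserShells LayeredLawsSelectHcp PalmRigidity ShellsToBarlowChart)
open Summit.AtomisticToContinuum.Crystallization.Theorems.PalmUnimodularRigidity.LayeredLawsSelectHcp
  (hcpE hcpQ tube_hcpE_unique_minimiser)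
open Summit.AtomisticToContinuum.Crystallization.Theorems.ExcessDecayLiouvilleCoarseGrains (hcpEnergySeries_of_eq)

/-! ## §1 The registered stubs (`sorry` lives only in these two theorems; signatures verbatim the sibling
route's items stmt-AtomisticToContinuum-9225 / -9226) -/

/-- **STUB 1 — measure-level local close packing** (= `PalmUnimodularRigidity.MinimiserShells`,
stmt-AtomisticToContinuum-9225, verbatim): a.s. the root of a minimising point-stationary hard-core law has a
(1/100)-close-packed first shell of twelve. THE CONTENT (open-problem strength). -/
theorem stub_minimiserShells :
    ∀ δ : ℝ, 0 < δ → ∀ P : MeasureTheory.Measure (MeasureTheory.Measure (EuclideanSpace ℝ (Fin 3))), MeasureTheory.IsProbabilityMeasure P → (∀ᵐ μ ∂P, (∃ S : Set (EuclideanSpace ℝ (Fin 3)), (0 : EuclideanSpace ℝ (Fin 3)) ∈ S ∧ (∀ x ∈ S, ∀ y ∈ S, x ≠ y → δ ≤ dist x y) ∧ μ = (MeasureTheory.Measure.count : MeasureTheory.Measure (EuclideanSpace ℝ (Fin 3))).restrict S)) → (∀ g : MeasureTheory.Measure (EuclideanSpace ℝ (Fin 3)) → EuclideanSpace ℝ (Fin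 3) → ENNReal, Measurable (Function.uncurry g) → ∫⁻ μ, ∫⁻ y, g μ y ∂μ ∂P = ∫⁻ μ, ∫⁻ y, g (MeasureTheory.Measure.map (fun z => z - y) μ) (-y) ∂μ ∂P) → (∫ μ, (∫ y, Literature.MathematicalPhysics.StatisticalMechanics.lennardJones ‖y‖ ∂μ) / 2 ∂P) ≤ (⨅ Q : Literature.MathematicalPhysics.StatisticalMechanics.PeriodicConfiguration 3, Q.energyPerParticle Literature.MathematicalPhysics.StatisticalMechanics.lennardJones) → ∀ᵐ μ ∂P, (∃ a : ℝ, 9 / 10 ≤ a ∧ a ≤ 1 ∧ ∃ T : Finset (EuclideanSpace ℝ (Fin 3)), (↑T : Set (EuclideanSpace ℝ (Fin 3))) = {y : EuclideanSpace ℝ (Fin 3) | μ {y} ≠ 0 ∧ y ≠ 0 ∧ ‖y‖ ≤ 5 / 4 * a} ∧ (Literature.Geometry.DiscreteGeometry.ShellCloseTo (a / 100) T (Finset.image (fun v : EuclideanSpace ℝ (Fin 3) => a • v) Literature.Geometry.DiscreteGeometry.fccKissingPattern) ∨ Literature.Geometry.DiscreteGeometry.ShellCloseTo (a / 100) T (Finset.image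 (fun v : EuclideanSpace ℝ (Fin 3) => a • v) Literature.Geometry.DiscreteGeometry.hcpKissingPattern))) := by
  sorry

/-- **STUB 2 — selection and rigidity in density form** (= `PalmUnimodularRigidity.LayeredLawsSelectHcp`,
stmt-AtomisticToContinuum-9226, verbatim): an a.s. everywhere-close-packed, Barlow-charted minimising law is
a.s. an exact rotated relaxed hcp crystal with optimal parameters. XL. -/
theorem stub_layeredLawsSelectHcp :
    ∀ δ : ℝ, 0 < δ → ∀ P : MeasureTheory.Measure (MeasureTheory.Measure (EuclideanSpace ℝ (Fin 3))), MeasureTheory.IsProbabilityMeasure P → (∀ᵐ μ ∂P, (∃ S : Set (EuclideanSpace ℝ (Fin 3)), (0 : EuclideanSpace ℝ (Fin 3)) ∈ S ∧ (∀ x ∈ S, ∀ y ∈ S, x ≠ y → δ ≤ dist x y) ∧ μ = (MeasureTheory.Measure.count : MeasureTheory.Measure (EuclideanSpace ℝ (Fin 3))).restrict S)) → (∀ g : MeasureTheory.Measure (EuclideanSpace ℝ (Fin 3)) → EuclideanSpace ℝ (Fin 3) → ENNReal, Measurable (Function.uncurry g) → ∫⁻ μ, ∫⁻ y, g μ y ∂μ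 ∂P = ∫⁻ μ, ∫⁻ y, g (MeasureTheory.Measure.map (fun z => z - y) μ) (-y) ∂μ ∂P) → (∫ μ, (∫ y, Literature.MathematicalPhysics.StatisticalMechanics.lennardJones ‖y‖ ∂μ) / 2 ∂P) ≤ (⨅ Q : Literature.MathematicalPhysics.StatisticalMechanics.PeriodicConfiguration 3, Q.energyPerParticle Literature.MathematicalPhysics.StatisticalMechanics.lennardJones) → (∀ᵐ μ ∂P, ∃ S : Set (EuclideanSpace ℝ (Fin 3)), μ = (MeasureTheory.Measure.count : MeasureTheory.Measure (EuclideanSpace ℝ (Fin 3))).restrict S ∧ (∀ x ∈ S, (∃ a : ℝ, 9 / 10 ≤ a ∧ a ≤ 1 ∧ ∃ T : Finset (EuclideanSpace ℝ (Fin 3)), (↑T : Set (EuclideanSpace ℝ (Fin 3))) = (fun y : EuclideanSpace ℝ (Fin 3) => y - x) '' {y : EuclideanSpace ℝ (Fin 3) | y ∈ S ∧ y ≠ x ∧ dist y x ≤ 5 / 4 * a} ∧ (Literature.Geometry.DiscreteGeometry.ShellCloseTo (a / 100) T (Finset.image (fun v : EuclideanSpace ℝ (Fin 3) => a • v) Literature.Geometry.DiscreteGeometry.fccKissingPattern)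 ∨ Literature.Geometry.DiscreteGeometry.ShellCloseTo (a / 100) T (Finset.image (fun v : EuclideanSpace ℝ (Fin 3) => a • v) Literature.Geometry.DiscreteGeometry.hcpKissingPattern)))) ∧ (∃ s : ℤ → ℤ, Literature.MathematicalPhysics.StatisticalMechanics.IsHaggSeq s ∧ ∃ Φ : EuclideanSpace ℝ (Fin 3) → EuclideanSpace ℝ (Fin 3), Set.BijOn Φ (Literature.MathematicalPhysics.StatisticalMechanics.barlowStacking 1 (Real.sqrt (2 / 3)) s) S ∧ ∀ p ∈ Literature.MathematicalPhysics.StatisticalMechanics.barlowStacking 1 (Real.sqrt (2 / 3)) s, ∀ q ∈ Literature.MathematicalPhysics.StatisticalMechanics.barlowStacking 1 (Real.sqrt (2 / 3)) s, (dist p q = 1 ↔ (0 < dist (Φ p) (Φ q) ∧ dist (Φ p) (Φ q) ≤ 28 / 25)))) → ∀ᵐ μ ∂P, (∃ a h : ℝ, ∃ ha : a ≠ 0, ∃ hh : h ≠ 0, 1 / 2 ≤ a ∧ a ≤ 2 ∧ 1 / 2 ≤ h ∧ h ≤ 2 ∧ ∃ A : EuclideanSpace ℝ (Fin 3) ≃ₗᵢ[ℝ]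 EuclideanSpace ℝ (Fin 3), (Literature.MathematicalPhysics.StatisticalMechanics.hcpPeriodicConfiguration ha hh).energyPerParticle Literature.MathematicalPhysics.StatisticalMechanics.lennardJones = (⨅ Q : Literature.MathematicalPhysics.StatisticalMechanics.PeriodicConfiguration 3, Q.energyPerParticle Literature.MathematicalPhysics.StatisticalMechanics.lennardJones) ∧ μ = (MeasureTheory.Measure.count : MeasureTheory.Measure (EuclideanSpace ℝ (Fin 3))).restrict (A '' Literature.MathematicalPhysics.StatisticalMechanics.hcpStacking a h)) := by
  sorry

-- the registered stubs ARE the sibling route's items (definitional readback, both directions)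
example : MinimiserShells := stub_minimiserShells
example : LayeredLawsSelectHcp := stub_layeredLawsSelectHcp
example : MinimiserShells ↔ (∀ δ : ℝ, 0 < δ → ∀ P : MeasureTheory.Measure (MeasureTheory.Measure (EuclideanSpace ℝ (Fin 3))), MeasureTheory.IsProbabilityMeasure P → (∀ᵐ μ ∂P, (∃ S : Set (EuclideanSpace ℝ (Fin 3)), (0 : EuclideanSpace ℝ (Fin 3)) ∈ S ∧ (∀ x ∈ S, ∀ y ∈ S, x ≠ y → δ ≤ dist x y) ∧ μ = (MeasureTheory.Measure.count : MeasureTheory.Measure (EuclideanSpace ℝ (Fin 3))).restrict S)) → (∀ g : MeasureTheory.Measure (EuclideanSpace ℝ (Fin 3)) → EuclideanSpace ℝ (Fin 3) → ENNReal, Measurable (Function.uncurry g) → ∫⁻ μ, ∫⁻ y, g μ y ∂μ ∂P = ∫⁻ μ, ∫⁻ y, g (MeasureTheory.Measure.map (fun z => z - y) μ) (-y) ∂μ ∂P) → (∫ μ, (∫ y, Literature.MathematicalPhysics.StatisticalMechanics.lennardJones ‖y‖ ∂μ) / 2 ∂P) ≤ (⨅ Q : Literature.MathematicalPhysics.StatisticalMechanics.PeriodicConfiguration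 3, Q.energyPerParticle Literature.MathematicalPhysics.StatisticalMechanics.lennardJones) → ∀ᵐ μ ∂P, (∃ a : ℝ, 9 / 10 ≤ a ∧ a ≤ 1 ∧ ∃ T : Finset (EuclideanSpace ℝ (Fin 3)), (↑T : Set (EuclideanSpace ℝ (Fin 3))) = {y : EuclideanSpace ℝ (Fin 3) | μ {y} ≠ 0 ∧ y ≠ 0 ∧ ‖y‖ ≤ 5 / 4 * a} ∧ (Literature.Geometry.DiscreteGeometry.ShellCloseTo (a / 100) T (Finset.image (fun v : EuclideanSpace ℝ (Fin 3) => a • v) Literature.Geometry.DiscreteGeometry.fccKissingPattern) ∨ Literature.Geometry.DiscreteGeometry.ShellCloseTo (a / 100) T (Finset.image (fun v : EuclideanSpace ℝ (Fin 3) => a • v) Literature.Geometry.DiscreteGeometry.hcpKissingPattern)))) := Iff.rfl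
example : LayeredLawsSelectHcp ↔ (∀ δ : ℝ, 0 < δ → ∀ P : MeasureTheory.Measure (MeasureTheory.Measure (EuclideanSpace ℝ (Fin 3))), MeasureTheory.IsProbabilityMeasure P → (∀ᵐ μ ∂P, (∃ S : Set (EuclideanSpace ℝ (Fin 3)), (0 : EuclideanSpace ℝ (Fin 3)) ∈ S ∧ (∀ x ∈ S, ∀ y ∈ S, x ≠ y → δ ≤ dist x y) ∧ μ = (MeasureTheory.Measure.count : MeasureTheory.Measure (EuclideanSpace ℝ (Fin 3))).restrict S)) → (∀ g : MeasureTheory.Measure (EuclideanSpace ℝ (Fin 3)) → EuclideanSpace ℝ (Fin 3) → ENNReal, Measurable (Function.uncurry g) → ∫⁻ μ, ∫⁻ y, g μ y ∂μ ∂P = ∫⁻ μ, ∫⁻ y, g (MeasureTheory.Measure.map (fun z => z - y) μ) (-y) ∂μ ∂P) → (∫ μ, (∫ y, Literature.MathematicalPhysics.StatisticalMechanics.lennardJones ‖y‖ ∂μ) / 2 ∂P) ≤ (⨅ Q : Literature.MathematicalPhysics.StatisticalMechanics.PeriodicConfiguration 3, Q.energyPerParticle Literature.MathematicalPhysics.StatisticalMechanics.lennardJones)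 → (∀ᵐ μ ∂P, ∃ S : Set (EuclideanSpace ℝ (Fin 3)), μ = (MeasureTheory.Measure.count : MeasureTheory.Measure (EuclideanSpace ℝ (Fin 3))).restrict S ∧ (∀ x ∈ S, (∃ a : ℝ, 9 / 10 ≤ a ∧ a ≤ 1 ∧ ∃ T : Finset (EuclideanSpace ℝ (Fin 3)), (↑T : Set (EuclideanSpace ℝ (Fin 3))) = (fun y : EuclideanSpace ℝ (Fin 3) => y - x) '' {y : EuclideanSpace ℝ (Fin 3) | y ∈ S ∧ y ≠ x ∧ dist y x ≤ 5 / 4 * a} ∧ (Literature.Geometry.DiscreteGeometry.ShellCloseTo (a / 100) T (Finset.image (fun v : EuclideanSpace ℝ (Fin 3) => a • v) Literature.Geometry.DiscreteGeometry.fccKissingPattern) ∨ Literature.Geometry.DiscreteGeometry.ShellCloseTo (a / 100) T (Finset.image (fun v : EuclideanSpace ℝ (Fin 3) => a • v) Literature.Geometry.DiscreteGeometry.hcpKissingPattern)))) ∧ (∃ s : ℤ → ℤ, Literature.MathematicalPhysics.StatisticalMechanics.IsHaggSeq s ∧ ∃ Φ : EuclideanSpace ℝ (Fin 3) → EuclideanSpace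 ℝ (Fin 3), Set.BijOn Φ (Literature.MathematicalPhysics.StatisticalMechanics.barlowStacking 1 (Real.sqrt (2 / 3)) s) S ∧ ∀ p ∈ Literature.MathematicalPhysics.StatisticalMechanics.barlowStacking 1 (Real.sqrt (2 / 3)) s, ∀ q ∈ Literature.MathematicalPhysics.StatisticalMechanics.barlowStacking 1 (Real.sqrt (2 / 3)) s, (dist p q = 1 ↔ (0 < dist (Φ p) (Φ q) ∧ dist (Φ p) (Φ q) ≤ 28 / 25)))) → ∀ᵐ μ ∂P, (∃ a h : ℝ, ∃ ha : a ≠ 0, ∃ hh : h ≠ 0, 1 / 2 ≤ a ∧ a ≤ 2 ∧ 1 / 2 ≤ h ∧ h ≤ 2 ∧ ∃ A : EuclideanSpace ℝ (Fin 3) ≃ₗᵢ[ℝ] EuclideanSpace ℝ (Fin 3), (Literature.MathematicalPhysics.StatisticalMechanics.hcpPeriodicConfiguration ha hh).energyPerParticle Literature.MathematicalPhysics.StatisticalMechanics.lennardJones = (⨅ Q : Literature.MathematicalPhysics.StatisticalMechanics.PeriodicConfiguration 3, Q.energyPerParticle Literature.MathematicalPhysics.StatisticalMechanics.lennardJones)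 ∧ μ = (MeasureTheory.Measure.count : MeasureTheory.Measure (EuclideanSpace ℝ (Fin 3))).restrict (A '' Literature.MathematicalPhysics.StatisticalMechanics.hcpStacking a h))) := Iff.rfl

/-! ## §2 Proved glue (sorry-free): pinning, uniqueness of the optimal parameters, the atom -/

/-- `hcpE a h = e(hcp a h)` for `a, h ≠ 0`: third clause of the landed series theorem
`hcpEnergySeries_of_eq`. [folklore] -/
theorem hcpE_eq_energyPerParticle {a h : ℝ} (ha : a ≠ 0) (hh : h ≠ 0) :
    hcpE a h = (hcpPeriodicConfiguration ha hh).energyPerParticle lennardJones :=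
  ((hcpEnergySeries_of_eq a h ha hh hcpQ rfl).2.2).symm

/-- **Pinning is free.** If `e(hcp a h) = ⨅_Q e(Q)` then `(a, h)` is a global minimiser of `hcpE` over the
open quadrant. [folklore] -/
theorem hcpE_globalMin_of_energy_eq_iInf {a h : ℝ} (ha : a ≠ 0) (hh : h ≠ 0)
    (hE : (hcpPeriodicConfiguration ha hh).energyPerParticle lennardJones =
      ⨅ Q : PeriodicConfiguration 3, Q.energyPerParticle lennardJones) :
    ∀ a' h' : ℝ, 0 < a' → 0 < h' → hcpE a h ≤ hcpE a' h' := by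
  intro a' h' ha' hh'
  rw [hcpE_eq_energyPerParticle ha hh, hE, hcpE_eq_energyPerParticle ha'.ne' hh'.ne']
  exact ciInf_le Summit.AtomisticToContinuum.Crystallization.Theorems.crysPeriodicBddBelow_proof _

/-- **Optimal hcp parameters are unique** in the positive quadrant (`tube_hcpE_unique_minimiser` after
pinning). [folklore] -/
theorem optimal_hcp_params_unique {a h a' h' : ℝ} (ha0 : 0 < a) (hh0 : 0 < h) (ha0' : 0 < a')
    (hh0' : 0 < h') (ha : a ≠ 0) (hh : h ≠ 0) (ha' : a' ≠ 0) (hh' : h' ≠ 0)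
    (hE : (hcpPeriodicConfiguration ha hh).energyPerParticle lennardJones =
      ⨅ Q : PeriodicConfiguration 3, Q.energyPerParticle lennardJones)
    (hE' : (hcpPeriodicConfiguration ha' hh').energyPerParticle lennardJones =
      ⨅ Q : PeriodicConfiguration 3, Q.energyPerParticle lennardJones) :
    a' = a ∧ h' = h := by
  refine tube_hcpE_unique_minimiser a h a' h' ha0 hh0 ha0' hh0'
    (hcpE_globalMin_of_energy_eq_iInf ha hh hE) ?_
  rw [hcpE_eq_energyPerParticle ha hh, hE, hcpE_eq_energyPerParticle ha' hh', hE']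

/-- A probability (outer) measure charges a set containing almost every point (no measurability needed).
[folklore] -/
theorem measure_pos_of_ae_mem {α : Type*} [MeasurableSpace α] {P : Measure α} [IsProbabilityMeasure P]
    {s : Set α} (h : ∀ᵐ x ∂P, x ∈ s) : 0 < P s := by
  have hc : P sᶜ = 0 := mem_ae_iff.1 h
  by_contra hs
  have hs0 : P s = 0 := nonpos_iff_eq_zero.1 (not_lt.1 hs)
  have h1 : P Set.univ ≤ 0 :=
    calc P Set.univ = P (s ∪ sᶜ) := by rw [Set.union_compl_self]
      _ ≤ P s + P sᶜ := measure_union_le _ _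
      _ = 0 := by rw [hs0, hc, add_zero]
  have h2 : P Set.univ = 0 := nonpos_iff_eq_zero.1 h1
  rw [measure_univ] at h2
  exact one_ne_zero h2

/-- The root is a site of the hcp stacking (`haggLabel s 0 = 0`). [folklore] -/
theorem zero_mem_hcpStacking (a h : ℝ) : (0 : EuclideanSpace ℝ (Fin 3)) ∈ hcpStacking a h := by
  refine ⟨0, 0, 0, ?_⟩
  simp [barlowPos]

/-- **An a.s.-hcp law charges ONE rooted class.** If almost every sample of a probability law `P` is a
rotated relaxed hcp crystal `count|A(hcpStacking a h)` with OPTIMAL parameters (the conclusion of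
`PalmRigidity` for `P`), then `P` charges the exact rooted isometry class of one set `Y`: the optimal
parameters are unique (`optimal_hcp_params_unique`), so almost every sample is `count|A(Y − 0)` for the SAME
`Y = hcpStacking a₀ h₀` (`0 ∈ Y`), and that class has outer measure `1 > 0`. Stated with an `∃`-headed
conclusion (not the crux decl) so that the skeleton theorem below is the only theorem concluding the crux.
[folklore] -/
theorem exists_charged_class_of_ae_hcp {P : Measure (Measure (EuclideanSpace ℝ (Fin 3)))}
    [IsProbabilityMeasure P]
    (hae : ∀ᵐ μ ∂P, (∃ a h : ℝ, ∃ ha : a ≠ 0, ∃ hh : h ≠ 0, 1 / 2 ≤ a ∧ a ≤ 2 ∧ 1 / 2 ≤ h ∧ h ≤ 2 ∧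
      ∃ A : EuclideanSpace ℝ (Fin 3) ≃ₗᵢ[ℝ] EuclideanSpace ℝ (Fin 3),
        (hcpPeriodicConfiguration ha hh).energyPerParticle lennardJones =
          (⨅ Q : PeriodicConfiguration 3, Q.energyPerParticle lennardJones) ∧
        μ = (Measure.count : Measure (EuclideanSpace ℝ (Fin 3))).restrict (A '' hcpStacking a h))) :
    ∃ Y : Set (EuclideanSpace ℝ (Fin 3)), 0 < P {μ | ∃ A : EuclideanSpace ℝ (Fin 3) →ₗᵢ[ℝ]
      EuclideanSpace ℝ (Fin 3), ∃ q ∈ Y, μ = (Measure.count : Measure (EuclideanSpace ℝ (Fin 3))).restrict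
        ((fun s => A (s - q)) '' Y)} := by
  obtain ⟨μ₀, hμ₀⟩ := hae.exists
  obtain ⟨a₀, h₀, ha₀, hh₀, ha₀l, -, hh₀l, -, A₀, hE₀, -⟩ := hμ₀
  have ha₀p : 0 < a₀ := by linarith
  have hh₀p : 0 < h₀ := by linarith
  refine ⟨hcpStacking a₀ h₀, measure_pos_of_ae_mem ?_⟩
  filter_upwards [hae] with μ hμ
  obtain ⟨a, h, ha, hh, hal, -, hhl, -, A, hE, rfl⟩ := hμ
  have hap : 0 < a := by linarith
  have hhp : 0 < h := by linarith
  obtain ⟨rfl, rfl⟩ := optimal_hcp_params_unique ha₀p hh₀p hap hhp ha₀ hh₀ ha hh hE₀ hE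
  refine ⟨A.toLinearIsometry, 0, zero_mem_hcpStacking a h, ?_⟩
  congr 1
  refine Set.image_congr' fun s => ?_
  simp

/-- **The sibling's target gives PURITY** (`PalmRigidity → MinimisingLawsHaveAtoms`, stmt-9224 ⇒ stmt-15776;
an `example`, so that `MinimisingLawsHaveAtoms_of` stays the unique skeleton theorem). The frame hypotheses of
the two routes agree definitionally. -/
example (hPalm : PalmRigidity) : MinimisingLawsHaveAtoms := fun δ hδ P hP hcore hstat hmin =>
  haveI : IsProbabilityMeasure P := hP
  exists_charged_class_of_ae_hcp (hPalm δ hδ P hP hcore hstat hmin)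

/-! ## §3 The skeleton theorem -/

/-- **`MinimisingLawsHaveAtoms_of`** — the two registered stubs (by the names of the sibling route's items they
coincide with) give the crux `MinimisingLawsHaveAtoms` BY NAME: `cruxesToPalmRigidity_proof` (landed glue
9228) fed with `ShellsToBarlowChart_of` (landed crux 9227) gives `PalmRigidity`, and
`exists_charged_class_of_ae_hcp` the atom. -/
theorem MinimisingLawsHaveAtoms_of (h₁ : MinimiserShells) (h₂ : LayeredLawsSelectHcp) :
    MinimisingLawsHaveAtoms := fun δ hδ P hP hcore hstat hmin =>
  haveI : IsProbabilityMeasure P := hP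
  exists_charged_class_of_ae_hcp
    (Summit.AtomisticToContinuum.Crystallization.Theorems.PalmUnimodularRigidity.cruxesToPalmRigidity_proof
      h₁
      Summit.AtomisticToContinuum.Crystallization.Cruxes.ShellsToBarlowChart.DevelopTheModelGrowthDescent.ShellsToBarlowChart_of
      h₂ δ hδ P hP hcore hstat hmin)

/-- Wiring check: the registered stubs feed the composition exactly as stated. -/
example : MinimisingLawsHaveAtoms := MinimisingLawsHaveAtoms_of stub_minimiserShells stub_layeredLawsSelectHcp

end Summit.AtomisticToContinuum.Crystallization.Cruxes.MinimisingLawsHaveAtoms.HcpTransfer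

end
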